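import Mathlib
import Literature.Analysis.FluidPDE.SuitableWeak
import Literature.Analysis.FluidPDE.LerayHopfProofs
import Summits.NavierStokesRegularity.NavierStokesRegularity.Theses.EulerZoomLiouville
import HarnessLib

/-!
# The SPATIALLY PERIODIC stratum of the crux `EulerZoomLiouville.PowerGaugeEulerLiouville`
# (route №10 `EulerZoomLiouville`, item stmt-NavierStokesRegularity-19832) — every `ρ > 0`

Helper file (theorems only; `--supports stmt-NavierStokesRegularity-19832`, line `birth`, a stratum of
STUB 3 `stub_noCollapseFromZero`). Seat ns-typeII-p3 (cell ns-regularity-ideate §B, D-0081).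

THE STRATUM. Let `(u, p)` be an ancient local-energy Euler flow on `(−∞,0) × ℝ³` in Seregin's
power-gauged class with exponent `ρ > 0` (suitable weak, `ν = 0`, `f = 0`, weak spatial gradient `H`,
`a^{2ρ} A(a) + a^{ρ} E(a) + a^{2ρ} D(a) ≤ c` at the origin for every `a > 0`), and suppose every slice
is PERIODIC IN ONE SPACE DIRECTION: `u(τ, y + v) = u(τ, y)` for all `τ < 0`, `y ∈ ℝ³`, with a fixed
period vector `v ≠ 0`.  Then `u = 0` a.e. on the slab — `powerGaugeEulerLiouville_spacePeriodic`.  The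
stratum CONTAINS the planar / 2½-dimensional members (fields independent of one coordinate are periodic of
every period in that direction), so inside Seregin's class the two-dimensional Chae–Shvydkoy question is
moot.  Like rungs A/B this is a FLOOR label (critic-2's K-READ 01 §K5): only the ARITHMETIC of the
`A`-weight is used — `A(a) = sup_{−a²<τ<0} a⁻¹ ∫_{B_a} |u(τ)|²` (tree `cknA`, a genuine `sup`), so
`∫_{B_a} |u(τ)|² ≤ c · a^{1−2ρ}` for every slice `τ ∈ (−a², 0)`; no Euler system, no pressure, no `E`-gauge,
no local energy inequality.

THE PROOF. Fix `τ < 0`, `R > 0` and a period multiple `w = m v` with `‖w‖ ≥ 2R`.  The balls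
`B(k w, R)`, `k < n`, are pairwise disjoint, each carries the mass `I = ∫_{B(0,R)} |u(τ)|²`
(`setLIntegral_ball_translate` + periodicity), and all lie in `B(0, a)` for `a = nL`,
`L = ‖w‖ + R + √(−τ) + 1` (`mul_sliceBall_le`, `iUnion_ball_subset`); since `τ ∈ (−a², 0)` the `A`-gauge gives
`n · I ≤ c · a^{1−2ρ} = c L^{1−2ρ} n^{1−2ρ}` (`slice_ball_le_of_gaugeA`), i.e. `I ≤ c L^{1−2ρ} n^{−2ρ} → 0`:
`I = 0` for EVERY slice `τ < 0` and radius `R` (`slice_ball_eq_zero_of_periodic`).  Tonelli on the boxes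
`(−N−1, 0) × B_{N+1}` (which exhaust the slab) turns this into `u = 0` a.e.
`spacePeriodic_of_powerGaugeEulerLiouville` records that the stratum is a literal sub-case of the route
decl (strictly inside `E`, never summit-strength).

WHAT THIS IS NOT: not NS, not the crux (OPEN on `0 < ρ ≤ 1/2`: the Chae–Shvydkoy window for genuinely
three-dimensional, non-periodic, transient members). [folklore]
-/

noncomputable section

-- the summit and its single problem share the name `NavierStokesRegularity` (D-0017 nested layout)
set_option linter.dupNamespace false

open Set Function Filter Topology MeasureTheory Metric TopologicalSpace
open scoped NNReal ENNReal InnerProductSpace RealInnerProductSpace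

namespace Summit.NavierStokesRegularity.NavierStokesRegularity.Theorems.PowerGaugeEulerLiouville.SpacePeriodic

open Literature.Analysis Literature.Analysis.FluidPDE

/-! ## (1) Translating balls -/

/-- **Translation of a ball integral**: `∫_{B(b,R)} g = ∫_{B(0,R)} g(· + b)` (Lebesgue measure on `ℝ³`
is translation invariant). [folklore] -/
theorem setLIntegral_ball_translate (g : EuclideanSpace ℝ (Fin 3) → ℝ≥0∞)
    (b : EuclideanSpace ℝ (Fin 3)) (R : ℝ) :
    ∫⁻ x in ball b R, g x = ∫⁻ x in ball (0 : EuclideanSpace ℝ (Fin 3)) R, g (x + b) := by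
  rw [← lintegral_indicator measurableSet_ball, ← lintegral_indicator measurableSet_ball,
    ← lintegral_add_right_eq_self (μ := (volume : Measure (EuclideanSpace ℝ (Fin 3))))
      ((ball b R).indicator g) b]
  congr 1
  funext x
  have hiff : x + b ∈ ball b R ↔ x ∈ ball (0 : EuclideanSpace ℝ (Fin 3)) R := by
    rw [mem_ball, mem_ball_zero_iff, dist_eq_norm, add_sub_cancel_right]
  by_cases hx : x ∈ ball (0 : EuclideanSpace ℝ (Fin 3)) R
  · rw [indicator_of_mem (hiff.2 hx), indicator_of_mem hx]
  · rw [indicator_of_notMem (fun h => hx (hiff.1 h)), indicator_of_notMem hx]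

/-! ## (2) The `A`-gauge on one slice -/

/-- **The `A`-gauge bounds every slice in its window**: if `a^{2ρ} A(u; Q_a(0)) ≤ c`, `a > 0` and
`−a² < τ < 0`, then `∫_{B_a} |u(τ)|² ≤ c · a^{1−2ρ}`. [folklore] -/
theorem slice_ball_le_of_gaugeA {ρ : ℝ} {u : ℝ → EuclideanSpace ℝ (Fin 3) → EuclideanSpace ℝ (Fin 3)}
    {c : ℝ≥0} {a τ : ℝ} (ha : 0 < a) (hτa : -(a ^ 2) < τ) (hτ : τ < 0)
    (hA : ENNReal.ofReal (a ^ (2 * ρ)) * cknA a (0 : ℝ × EuclideanSpace ℝ (Fin 3)) u ≤ (c : ℝ≥0∞)) :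
    ∫⁻ x in ball (0 : EuclideanSpace ℝ (Fin 3)) a, ‖u τ x‖ₑ ^ 2 ≤
      ENNReal.ofReal ((c : ℝ) * a ^ (1 - 2 * ρ)) := by
  set I : ℝ≥0∞ := ∫⁻ x in ball (0 : EuclideanSpace ℝ (Fin 3)) a, ‖u τ x‖ₑ ^ 2 with hI
  have hslice : (ENNReal.ofReal a)⁻¹ * I ≤ cknA a (0 : ℝ × EuclideanSpace ℝ (Fin 3)) u := by
    unfold cknA
    have hs : τ ∈ Ioo ((0 : ℝ × EuclideanSpace ℝ (Fin 3)).1 - a ^ 2)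
        (0 : ℝ × EuclideanSpace ℝ (Fin 3)).1 := by
      simp only [Prod.fst_zero, zero_sub, mem_Ioo]
      exact ⟨hτa, hτ⟩
    exact le_iSup₂ (f := fun t (_ : t ∈ Ioo ((0 : ℝ × EuclideanSpace ℝ (Fin 3)).1 - a ^ 2)
        (0 : ℝ × EuclideanSpace ℝ (Fin 3)).1) =>
        (ENNReal.ofReal a)⁻¹ * ∫⁻ x in ball (0 : ℝ × EuclideanSpace ℝ (Fin 3)).2 a, ‖u t x‖ₑ ^ 2) τ hs
  have h1 : ENNReal.ofReal (a ^ (2 * ρ)) * ((ENNReal.ofReal a)⁻¹ * I) ≤ (c : ℝ≥0∞) :=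
    le_trans (mul_le_mul' le_rfl hslice) hA
  have h2 : ENNReal.ofReal (a ^ (2 * ρ)) * (ENNReal.ofReal a)⁻¹ = ENNReal.ofReal (a ^ (2 * ρ - 1)) := by
    rw [← ENNReal.ofReal_inv_of_pos ha, ← ENNReal.ofReal_mul (Real.rpow_nonneg ha.le _)]
    congr 1
    rw [Real.rpow_sub ha, Real.rpow_one, div_eq_mul_inv]
  rw [← mul_assoc, h2] at h1
  have hpos : 0 < a ^ (2 * ρ - 1) := Real.rpow_pos_of_pos ha _
  have h3 : I ≤ (c : ℝ≥0∞) / ENNReal.ofReal (a ^ (2 * ρ - 1)) := by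
    rw [ENNReal.le_div_iff_mul_le (Or.inl (ENNReal.ofReal_pos.2 hpos).ne') (Or.inl ENNReal.ofReal_ne_top),
      mul_comm]
    exact h1
  refine h3.trans (le_of_eq ?_)
  rw [← ENNReal.ofReal_coe_nnreal, ← ENNReal.ofReal_div_of_pos hpos]
  congr 1
  rw [div_eq_mul_inv, ← Real.rpow_neg ha.le, neg_sub]

/-! ## (3) Packing disjoint translated balls -/

/-- **`n` disjoint period-translates of `B(0,R)` carry `n` times its mass**: if `g(x + w) = g(x)` for
all `x` and `‖w‖ ≥ 2R`, then `n · ∫_{B(0,R)} g ≤ ∫_{⋃_{k<n} B(k w, R)} g`. [folklore] -/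
theorem mul_sliceBall_le (g : EuclideanSpace ℝ (Fin 3) → ℝ≥0∞) {w : EuclideanSpace ℝ (Fin 3)} {R : ℝ}
    (hper : ∀ x, g (x + w) = g x) (hw : 2 * R ≤ ‖w‖) (n : ℕ) :
    (n : ℝ≥0∞) * ∫⁻ x in ball (0 : EuclideanSpace ℝ (Fin 3)) R, g x ≤
      ∫⁻ x in ⋃ k ∈ Finset.range n, ball ((k : ℝ) • w) R, g x := by
  -- periodicity under all natural multiples of `w`
  have hperk : ∀ k : ℕ, ∀ x, g (x + (k : ℝ) • w) = g x := by
    intro k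
    induction k with
    | zero => intro x; simp
    | succ k ih =>
      intro x
      rw [Nat.cast_succ, add_smul, one_smul, ← add_assoc, hper, ih]
  -- each translate carries the same mass
  have hmass : ∀ k : ℕ, ∫⁻ x in ball ((k : ℝ) • w) R, g x =
      ∫⁻ x in ball (0 : EuclideanSpace ℝ (Fin 3)) R, g x := by
    intro k
    rw [setLIntegral_ball_translate]
    simp_rw [hperk k]
  induction n with
  | zero => simp
  | succ n ih =>
    -- the new ball is disjoint from the previous ones
    have hdisj : Disjoint (⋃ k ∈ Finset.range n, ball ((k : ℝ) • w) R) (ball ((n : ℝ) • w) R) := by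
      refine disjoint_iUnion₂_left.2 fun k hk => ?_
      have hk' : (k : ℝ) + 1 ≤ n := by exact_mod_cast Finset.mem_range.1 hk
      refine ball_disjoint_ball ?_
      rw [dist_eq_norm, ← sub_smul, norm_smul, Real.norm_eq_abs, abs_sub_comm,
        abs_of_nonneg (by linarith)]
      nlinarith [norm_nonneg w]
    rw [Finset.range_add_one, Finset.set_biUnion_insert, union_comm,
      lintegral_union measurableSet_ball hdisj, hmass n]
    calc (((n + 1 : ℕ) : ℝ≥0∞)) * ∫⁻ x in ball (0 : EuclideanSpace ℝ (Fin 3)) R, g x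
        = (n : ℝ≥0∞) * (∫⁻ x in ball (0 : EuclideanSpace ℝ (Fin 3)) R, g x) +
            ∫⁻ x in ball (0 : EuclideanSpace ℝ (Fin 3)) R, g x := by
          push_cast; ring
      _ ≤ (∫⁻ x in ⋃ k ∈ Finset.range n, ball ((k : ℝ) • w) R, g x) +
            ∫⁻ x in ball (0 : EuclideanSpace ℝ (Fin 3)) R, g x := add_le_add ih le_rfl

/-- The first `n` translates lie in the ball `B(0, n‖w‖ + R)`. [folklore] -/
theorem iUnion_ball_subset {w : EuclideanSpace ℝ (Fin 3)} {R : ℝ} (n : ℕ) :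
    (⋃ k ∈ Finset.range n, ball ((k : ℝ) • w) R) ⊆
      ball (0 : EuclideanSpace ℝ (Fin 3)) ((n : ℝ) * ‖w‖ + R) := by
  refine iUnion₂_subset fun k hk => ?_
  have hk' : (k : ℝ) + 1 ≤ n := by exact_mod_cast Finset.mem_range.1 hk
  intro x hx
  rw [mem_ball_zero_iff]
  rw [mem_ball, dist_eq_norm] at hx
  calc ‖x‖ = ‖(x - (k : ℝ) • w) + (k : ℝ) • w‖ := by rw [sub_add_cancel]
    _ ≤ ‖x - (k : ℝ) • w‖ + ‖(k : ℝ) • w‖ := norm_add_le _ _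
    _ < R + (k : ℝ) * ‖w‖ := by
        rw [norm_smul, Real.norm_eq_abs, abs_of_nonneg (by positivity)]
        linarith
    _ ≤ (n : ℝ) * ‖w‖ + R := by nlinarith [norm_nonneg w]

/-! ## (4) Every slice of a spatially periodic member vanishes on every ball -/

/-- **Slices of a spatially periodic member vanish**: if `u(τ, · + v) = u(τ, ·)` (`v ≠ 0`) for some
`τ < 0` and `a^{2ρ} A(u; Q_a(0)) ≤ c` for all `a > 0` (`ρ > 0`), then `∫_{B(0,R)} |u(τ)|² = 0` for every
`R > 0`: with `w = m v`, `‖w‖ ≥ 2R`, and `a = nL`, `L = ‖w‖ + R + √(−τ) + 1`, packing and the `A`-gauge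
give `n · I ≤ c (nL)^{1−2ρ}`, i.e. `I ≤ c L^{1−2ρ} n^{−2ρ} → 0`. [folklore] -/
theorem slice_ball_eq_zero_of_periodic {ρ : ℝ} (hρ : 0 < ρ)
    {u : ℝ → EuclideanSpace ℝ (Fin 3) → EuclideanSpace ℝ (Fin 3)} {c : ℝ≥0}
    (hA : ∀ a : ℝ, 0 < a →
      ENNReal.ofReal (a ^ (2 * ρ)) * cknA a (0 : ℝ × EuclideanSpace ℝ (Fin 3)) u ≤ (c : ℝ≥0∞))
    {v : EuclideanSpace ℝ (Fin 3)} (hv : v ≠ 0) {τ : ℝ} (hτ : τ < 0)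
    (hper : ∀ y, u τ (y + v) = u τ y) {R : ℝ} (hR : 0 < R) :
    ∫⁻ x in ball (0 : EuclideanSpace ℝ (Fin 3)) R, ‖u τ x‖ₑ ^ 2 = 0 := by
  set g : EuclideanSpace ℝ (Fin 3) → ℝ≥0∞ := fun x => ‖u τ x‖ₑ ^ 2 with hg
  set I : ℝ≥0∞ := ∫⁻ x in ball (0 : EuclideanSpace ℝ (Fin 3)) R, g x with hI
  -- a period multiple `w = m v` with `‖w‖ ≥ 2R`
  have hvpos : 0 < ‖v‖ := norm_pos_iff.2 hv
  obtain ⟨m, hm⟩ := exists_nat_gt (2 * R / ‖v‖)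
  set w : EuclideanSpace ℝ (Fin 3) := (m : ℝ) • v with hw
  have hwnorm : 2 * R ≤ ‖w‖ := by
    rw [hw, norm_smul, Real.norm_eq_abs, abs_of_nonneg (by positivity)]
    rw [div_lt_iff₀ hvpos] at hm
    linarith
  have hperw : ∀ x, g (x + w) = g x := by
    have hk : ∀ k : ℕ, ∀ x, u τ (x + (k : ℝ) • v) = u τ x := by
      intro k
      induction k with
      | zero => intro x; simp
      | succ k ih =>
        intro x
        rw [Nat.cast_succ, add_smul, one_smul, ← add_assoc, hper, ih]
    intro x
    simp only [hg, hw, hk m x]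
  -- the scale `L` and the bound `I ≤ c L^{1-2ρ} n^{-2ρ}` for `n ≥ 1`
  set L : ℝ := ‖w‖ + R + Real.sqrt (-τ) + 1 with hL
  have hL1 : 1 ≤ L := by
    have := norm_nonneg w
    have := Real.sqrt_nonneg (-τ)
    linarith
  have hL0 : 0 < L := by linarith
  have key : ∀ n : ℕ, 1 ≤ n → I ≤ ENNReal.ofReal ((c : ℝ) * L ^ (1 - 2 * ρ) * (n : ℝ) ^ (-(2 * ρ))) := by
    intro n hn
    have hn' : (1 : ℝ) ≤ n := by exact_mod_cast hn
    have hn0 : (0 : ℝ) < n := by linarith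
    set a : ℝ := (n : ℝ) * L with ha
    have ha0 : 0 < a := mul_pos hn0 hL0
    -- `τ ∈ (−a², 0)`: `a ≥ L > √(−τ)`
    have haL : L ≤ a := by rw [ha]; nlinarith
    have hτa : -(a ^ 2) < τ := by
      have h1 : Real.sqrt (-τ) ^ 2 = -τ := Real.sq_sqrt (by linarith)
      have h2 : Real.sqrt (-τ) < a := by
        have := norm_nonneg w
        linarith
      nlinarith [Real.sqrt_nonneg (-τ)]
    -- packing inside `B(0, a)`
    have hsub : (⋃ k ∈ Finset.range n, ball ((k : ℝ) • w) R) ⊆ ball (0 : EuclideanSpace ℝ (Fin 3)) a := by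
      refine (iUnion_ball_subset n).trans (ball_subset_ball ?_)
      rw [ha, hL]
      have := Real.sqrt_nonneg (-τ)
      nlinarith [norm_nonneg w]
    have h1 : (n : ℝ≥0∞) * I ≤ ENNReal.ofReal ((c : ℝ) * a ^ (1 - 2 * ρ)) :=
      calc (n : ℝ≥0∞) * I ≤ ∫⁻ x in ⋃ k ∈ Finset.range n, ball ((k : ℝ) • w) R, g x :=
            mul_sliceBall_le g hperw hwnorm n
        _ ≤ ∫⁻ x in ball (0 : EuclideanSpace ℝ (Fin 3)) a, g x := lintegral_mono_set hsub
        _ ≤ ENNReal.ofReal ((c : ℝ) * a ^ (1 - 2 * ρ)) := slice_ball_le_of_gaugeA ha0 hτa hτ (hA a ha0)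
    -- divide by `n`
    have hn0' : (n : ℝ≥0∞) ≠ 0 := by exact_mod_cast (show (n : ℕ) ≠ 0 by exact_mod_cast hn0.ne')
    have h2 : I ≤ ENNReal.ofReal ((c : ℝ) * a ^ (1 - 2 * ρ)) / (n : ℝ≥0∞) := by
      rw [ENNReal.le_div_iff_mul_le (Or.inl hn0') (Or.inl (ENNReal.natCast_ne_top n)), mul_comm]
      exact h1
    refine h2.trans (le_of_eq ?_)
    rw [← ENNReal.ofReal_natCast, ← ENNReal.ofReal_div_of_pos hn0]
    congr 1
    rw [ha, Real.mul_rpow hn0.le hL0.le, Real.rpow_sub hn0, Real.rpow_one, Real.rpow_neg hn0.le]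
    field_simp
  -- the right-hand side tends to `0`
  have hlim : Tendsto (fun n : ℕ => ENNReal.ofReal ((c : ℝ) * L ^ (1 - 2 * ρ) * (n : ℝ) ^ (-(2 * ρ))))
      atTop (𝓝 0) := by
    have h1 : Tendsto (fun n : ℕ => ((n : ℝ)) ^ (-(2 * ρ))) atTop (𝓝 0) :=
      (tendsto_rpow_neg_atTop (by linarith : 0 < 2 * ρ)).comp tendsto_natCast_atTop_atTop
    have h2 := h1.const_mul ((c : ℝ) * L ^ (1 - 2 * ρ))
    rw [mul_zero] at h2
    have h3 := ENNReal.tendsto_ofReal h2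
    rwa [ENNReal.ofReal_zero] at h3
  have hev : ∀ᶠ n : ℕ in atTop, I ≤ ENNReal.ofReal ((c : ℝ) * L ^ (1 - 2 * ρ) * (n : ℝ) ^ (-(2 * ρ))) :=
    (eventually_ge_atTop 1).mono fun n hn => key n hn
  exact le_antisymm (le_of_tendsto_of_tendsto tendsto_const_nhds hlim hev) bot_le

/-! ## (5) The stratum -/

/-- **The SPATIALLY PERIODIC stratum of `EulerZoomLiouville.PowerGaugeEulerLiouville`, every `ρ > 0`.**
An ancient local-energy Euler flow `(u, p)` on `(−∞, 0) × ℝ³` (suitable weak, `ν = 0`, `f = 0`, weak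
spatial gradient `H`) in Seregin's power-gauged class `a^{2ρ} A(a) + a^{ρ} E(a) + a^{2ρ} D(a) ≤ c`
(all `a > 0`) whose slices are periodic in one space direction — `u(τ, y + v) = u(τ, y)` for all
`τ < 0`, `y`, with `v ≠ 0` — vanishes a.e. on the slab.  Only the `A`-gauge is used
(`slice_ball_eq_zero_of_periodic` for every slice, then Tonelli on boxes exhausting the slab); the
Euler system, `H`, `p` and the local energy inequality (`_hsw`) are not used beyond the measurability of
`u` supplied by `hH`.  Contains the planar / 2½-D members. [folklore] -/
theorem powerGaugeEulerLiouville_spacePeriodic :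
    ∀ ρ : ℝ, 0 < ρ → ∀ (u : ℝ → EuclideanSpace ℝ (Fin 3) → EuclideanSpace ℝ (Fin 3))
      (p : ℝ → EuclideanSpace ℝ (Fin 3) → ℝ)
      (H : ℝ → EuclideanSpace ℝ (Fin 3) → EuclideanSpace ℝ (Fin 3) →L[ℝ] EuclideanSpace ℝ (Fin 3))
      (c : NNReal) (v : EuclideanSpace ℝ (Fin 3)), v ≠ 0 →
      (∀ τ : ℝ, τ < 0 → ∀ y : EuclideanSpace ℝ (Fin 3), u τ (y + v) = u τ y) →
      Literature.Analysis.FluidPDE.IsSuitableWeakSolutionOn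
          (Literature.Analysis.FluidPDE.slab (EuclideanSpace ℝ (Fin 3)) (Set.Iio 0) isOpen_Iio) 0 0 u p →
      Literature.Analysis.FluidPDE.HasWeakSpatialGradientOn
          (Literature.Analysis.FluidPDE.slab (EuclideanSpace ℝ (Fin 3)) (Set.Iio 0) isOpen_Iio) u H →
      (∀ a : ℝ, 0 < a →
        ENNReal.ofReal (a ^ (2 * ρ)) *
            Literature.Analysis.FluidPDE.cknA a (0 : ℝ × EuclideanSpace ℝ (Fin 3)) u +
          ENNReal.ofReal (a ^ ρ) *
            Literature.Analysis.FluidPDE.cknE a (0 : ℝ × EuclideanSpace ℝ (Fin 3)) H +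
          ENNReal.ofReal (a ^ (2 * ρ)) *
            Literature.Analysis.FluidPDE.cknD a (0 : ℝ × EuclideanSpace ℝ (Fin 3)) p ≤
          (c : ENNReal)) →
      Function.uncurry u =ᵐ[volume.restrict
        (Set.Iio (0 : ℝ) ×ˢ (Set.univ : Set (EuclideanSpace ℝ (Fin 3))))] 0 := by
  intro ρ hρ u p H c v hv hper _hsw hH hc
  have hA : ∀ a : ℝ, 0 < a → ENNReal.ofReal (a ^ (2 * ρ)) *
      cknA a (0 : ℝ × EuclideanSpace ℝ (Fin 3)) u ≤ (c : ℝ≥0∞) :=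
    fun a ha => le_trans (le_trans le_self_add le_self_add) (hc a ha)
  set f : ℝ × EuclideanSpace ℝ (Fin 3) → ℝ≥0∞ := fun z => ‖u z.1 z.2‖ₑ ^ 2 with hf
  have hmeas : AEStronglyMeasurable (uncurry u)
      (volume.restrict (Iio (0 : ℝ) ×ˢ (univ : Set (EuclideanSpace ℝ (Fin 3))))) := by
    have := hH.locallyIntegrableOn.aestronglyMeasurable
    simpa [slab] using this
  have hfm : AEMeasurable f (volume.restrict (Iio (0 : ℝ) ×ˢ (univ : Set (EuclideanSpace ℝ (Fin 3))))) :=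
    hmeas.enorm.pow_const 2
  -- on each box `(−N−1, 0) × B_{N+1}` the mass of `|u|²` vanishes (Tonelli + every slice vanishes)
  have hbox : ∀ N : ℕ, ∀ᵐ z ∂(volume.restrict
      (Ioo (-((N : ℝ) + 1)) 0 ×ˢ ball (0 : EuclideanSpace ℝ (Fin 3)) ((N : ℝ) + 1))), f z = 0 := by
    intro N
    have hsub : Ioo (-((N : ℝ) + 1)) 0 ×ˢ ball (0 : EuclideanSpace ℝ (Fin 3)) ((N : ℝ) + 1) ⊆
        Iio (0 : ℝ) ×ˢ (univ : Set (EuclideanSpace ℝ (Fin 3))) :=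
      prod_mono (fun τ hτ => hτ.2) (subset_univ _)
    have hfm' : AEMeasurable f (volume.restrict
        (Ioo (-((N : ℝ) + 1)) 0 ×ˢ ball (0 : EuclideanSpace ℝ (Fin 3)) ((N : ℝ) + 1))) :=
      hfm.mono_set hsub
    refine (lintegral_eq_zero_iff' hfm').1 ?_
    have hμ : (volume : Measure (ℝ × EuclideanSpace ℝ (Fin 3))).restrict
        (Ioo (-((N : ℝ) + 1)) 0 ×ˢ ball (0 : EuclideanSpace ℝ (Fin 3)) ((N : ℝ) + 1)) =
        (volume.restrict (Ioo (-((N : ℝ) + 1)) 0)).prod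
          (volume.restrict (ball (0 : EuclideanSpace ℝ (Fin 3)) ((N : ℝ) + 1))) := by
      rw [Measure.volume_eq_prod, Measure.prod_restrict]
    rw [hμ] at hfm' ⊢
    rw [lintegral_prod f hfm']
    refine (setLIntegral_congr_fun measurableSet_Ioo (fun τ hτ => ?_)).trans (lintegral_zero)
    exact slice_ball_eq_zero_of_periodic hρ hA hv hτ.2 (hper τ hτ.2) (by positivity)
  -- the boxes exhaust the slab
  have hU : (Iio (0 : ℝ) ×ˢ (univ : Set (EuclideanSpace ℝ (Fin 3)))) =
      ⋃ N : ℕ, (Ioo (-((N : ℝ) + 1)) 0 ×ˢ ball (0 : EuclideanSpace ℝ (Fin 3)) ((N : ℝ) + 1)) := by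
    ext z
    simp only [mem_prod, mem_Iio, mem_univ, and_true, mem_iUnion, mem_Ioo, mem_ball_zero_iff]
    constructor
    · intro hz
      obtain ⟨N, hN⟩ := exists_nat_gt (max (-z.1) ‖z.2‖)
      exact ⟨N, ⟨by linarith [le_max_left (-z.1) ‖z.2‖], hz⟩,
        by linarith [le_max_right (-z.1) ‖z.2‖]⟩
    · rintro ⟨N, ⟨-, h2⟩, -⟩
      exact h2
  have hall : ∀ᵐ z ∂(volume.restrict (Iio (0 : ℝ) ×ˢ (univ : Set (EuclideanSpace ℝ (Fin 3))))),
      f z = 0 := by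
    rw [hU, ae_restrict_iUnion_iff]
    exact hbox
  filter_upwards [hall] with z hz
  have h1 : ‖u z.1 z.2‖ₑ = 0 := by simpa [hf] using hz
  simpa [uncurry] using h1

/-- **The spatially periodic stratum is a literal sub-case of the crux**
`E = EulerZoomLiouville.PowerGaugeEulerLiouville` (stmt-NavierStokesRegularity-19832). [folklore] -/
theorem spacePeriodic_of_powerGaugeEulerLiouville
    (hE : Summit.NavierStokesRegularity.NavierStokesRegularity.Theses.EulerZoomLiouville.PowerGaugeEulerLiouville) :
    ∀ ρ : ℝ, 0 < ρ → ∀ (u : ℝ → EuclideanSpace ℝ (Fin 3) → EuclideanSpace ℝ (Fin 3))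
      (p : ℝ → EuclideanSpace ℝ (Fin 3) → ℝ)
      (H : ℝ → EuclideanSpace ℝ (Fin 3) → EuclideanSpace ℝ (Fin 3) →L[ℝ] EuclideanSpace ℝ (Fin 3))
      (c : NNReal) (v : EuclideanSpace ℝ (Fin 3)), v ≠ 0 →
      (∀ τ : ℝ, τ < 0 → ∀ y : EuclideanSpace ℝ (Fin 3), u τ (y + v) = u τ y) →
      Literature.Analysis.FluidPDE.IsSuitableWeakSolutionOn
          (Literature.Analysis.FluidPDE.slab (EuclideanSpace ℝ (Fin 3)) (Set.Iio 0) isOpen_Iio) 0 0 u p →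
      Literature.Analysis.FluidPDE.HasWeakSpatialGradientOn
          (Literature.Analysis.FluidPDE.slab (EuclideanSpace ℝ (Fin 3)) (Set.Iio 0) isOpen_Iio) u H →
      (∀ a : ℝ, 0 < a →
        ENNReal.ofReal (a ^ (2 * ρ)) *
            Literature.Analysis.FluidPDE.cknA a (0 : ℝ × EuclideanSpace ℝ (Fin 3)) u +
          ENNReal.ofReal (a ^ ρ) *
            Literature.Analysis.FluidPDE.cknE a (0 : ℝ × EuclideanSpace ℝ (Fin 3)) H +
          ENNReal.ofReal (a ^ (2 * ρ)) *
            Literature.Analysis.FluidPDE.cknD a (0 : ℝ × EuclideanSpace ℝ (Fin 3)) p ≤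
          (c : ENNReal)) →
      Function.uncurry u =ᵐ[volume.restrict
        (Set.Iio (0 : ℝ) ×ˢ (Set.univ : Set (EuclideanSpace ℝ (Fin 3))))] 0 :=
  fun ρ hρ u p H c _v _hv _hper hsw hH hc => hE ρ hρ u p H c hsw hH hc

end Summit.NavierStokesRegularity.NavierStokesRegularity.Theorems.PowerGaugeEulerLiouville.SpacePeriodic

end
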